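/-
Copyright (c) 2026 the pub-hodgecm-mathlib formalisation cell (harness21).  Prover seat hodgecm-mathlib-K2E3-p23 (g5), HCML Track B «K2-LIT» ∕ h413
(`stmt-HodgeConjecture-24833`), line `K2_E3_EllipticInputs`, unit U12 «Characters», road «GL-[M6]-sc» (line lead K2E3-p23 (g5), dealer K2E3-plan (g3)),
brick T20-GL₃ (C-shell B) MIXED, FILE 1: the two cusp binders of ★ `cuspForm_cancellation_GL3_blockScalar` for the slice through a COMPANION Levi element.  2026-09-04.
-/
import Summits.HodgeConjecture.HodgeConjecture.Theorems.K2E3GL3SupercuspOrbitalSliceCuspidal     -- ★ (C-shell B) FILE 1 (K2E3-p21 g5): transports, `slice_mul_conj_eq`; brings ★ B4-E1, ★ B4-J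
import Summits.HodgeConjecture.HodgeConjecture.Theorems.K2E3GL3MixedCompanionNormalForm         -- ★ (K2E3-p17 g7): `charpoly_companion`
import Summits.HodgeConjecture.HodgeConjecture.Theorems.K2E3GL3MixedConjugacyVolume              -- ★ (this seat): `leviBlock_mem_standardLeviGL`
import HarnessLib

/-!
# Road «GL-[M6]-sc», brick T20 (C-shell B) mixed, FILE 1: THE SLICE `z ↦ B u' (ρ(π(z γ z⁻¹)) u)` THROUGH THE COMPANION LEVI ELEMENT
# `γ = [[0,−N,0],[1,T,0],[0,0,c]]`, `π(c) = c² − Tc + N ≠ 0`, IS A CUSP FORM ALONG `N_{(2,1)}` AND `N̄_{(2,1)}` (the binders `hcusp21`, `hcusp21bar` of ★ Theorem 20, `Γ = A₃`)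

Cell `pub/hodgecm-mathlib` (D-0151), Track B «K2-LIT», crux H413 = `stmt-HodgeConjecture-24833`, route of record `HCCMUnconditional`.  Lane
`--supports stmt-HodgeConjecture-24833 --as helper`; THEOREMS ONLY (no `def`, no `instance`, no `notation`, no named-fact hypothesis, no `sorry`); count-neutral.

Same mechanism as ★ K2E3-p21 (g5)'s `slice_hcusp21` for the split torus, WITHOUT Weyl chambers: `γ` lies in the Levi `M_{(2,1)}` (★ `leviBlock_mem_standardLeviGL`) and is
regular for `N_{(2,1)}` — `χ_{C_π}(c) = π(c) ≠ 0` (★ `charpoly_companion`) —, so ★ B4-E1 `integral_unipotentRadical21_conj_eq_zero_of_cuspForm` ∕ `…opposite…` apply to the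
matrix coefficient `g ↦ B u' (ρ(π g) u)`, a cusp form along every proper unipotent radical upstairs (★ B4-J `integral_sesqForm_apply_translate_unipotentRadicalGL_comp_mk_eq_zero'`
∕ `…_opposite_comp_mk_eq_zero`); the `Bool`- and `Fin 2`-labelled radicals are identified by ★ `unipotentRadicalGL_eq_of_forall_le_iff` + ★ `integral_comp_coe_eq_zero_of_eq`.
* `eval_charpoly_topLeft_companion`, **`slice_hcusp21_companion`**, **`slice_hcusp21bar_companion`**.
HONEST LABEL: HC_CM is proved only modulo the 7 printed citations (2 remaining named inputs: hLiu418 = stmt-HodgeConjecture-24832, h413 = stmt-HodgeConjecture-24833) until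
rung 0 closes; count-neutral helper, closes no socket.

## References
* [HarishChandra1970] Harish-Chandra (notes by G. van Dijk), *Harmonic Analysis on Reductive p-adic Groups*, LNM 162 (1970), Part VII §2 Theorem 20 p. 70, §8 Lemma 57.
* [Rogawski1990] J. Rogawski, *Automorphic Representations of Unitary Groups in Three Variables* (1990), §4.13 p. 70.
-/

set_option autoImplicit false
-- the mandated namespace repeats the single-problem summit's segment (`HodgeConjecture.HodgeConjecture`)
set_option linter.dupNamespace false

noncomputable section

open MeasureTheory Measure Polynomial
open scoped MatrixGroups
open Literature.NumberTheory.Automorphic Literature.NumberTheory.GaloisRepresentations Literature.NumberTheory.GaloisRepresentations.IsNonarchimedeanLocalField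
open Summit.HodgeConjecture.HodgeConjecture.Cruxes.H413.K2E3GL3SupercuspOrbitalSliceCuspidal
open Summit.HodgeConjecture.HodgeConjecture.Cruxes.H413.K2E3GL3CuspFormCancellationMaxParabolic
open Summit.HodgeConjecture.HodgeConjecture.Cruxes.H413.K2E3GL3SupercuspidalCuspFormOppositeRadicals
open Summit.HodgeConjecture.HodgeConjecture.Cruxes.H413.K2E3GL3MixedCompanionNormalForm
open Summit.HodgeConjecture.HodgeConjecture.Cruxes.H413.K2E3GL3MixedConjugacyVolume
open Summit.HodgeConjecture.HodgeConjecture.Cruxes.H413.K2E3GLnCongruenceIwahoriTriple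

namespace Summit.HodgeConjecture.HodgeConjecture.Cruxes.H413.K2E3GL3SupercuspOrbitalSliceMixedCuspidal

section Algebra

variable {F : Type*} [Field F]

/-- **Regularity of the companion Levi element for `N_{(2,1)}`**: the top-left block of `γ = [[0,−N,0],[1,T,0],[0,0,c]]` is the companion matrix `C_π`,
`π = X² − TX + N`, and `χ_{C_π}(γ₂₂) = π(c) = c² − Tc + N`. [cite: HarishChandra1970, Part VII §3 p. 72] -/
theorem eval_charpoly_topLeft_companion {γ : GL (Fin 3) F} {T N c : F} (hγ : (γ : Matrix (Fin 3) (Fin 3) F) = !![0, -N, 0; 1, T, 0; 0, 0, c]) :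
    ((!![(γ : Matrix (Fin 3) (Fin 3) F) 0 0, (γ : Matrix (Fin 3) (Fin 3) F) 0 1;
        (γ : Matrix (Fin 3) (Fin 3) F) 1 0, (γ : Matrix (Fin 3) (Fin 3) F) 1 1] : Matrix (Fin 2) (Fin 2) F)).charpoly.eval
      ((γ : Matrix (Fin 3) (Fin 3) F) 2 2) = c ^ 2 - T * c + N := by
  have h : (!![(γ : Matrix (Fin 3) (Fin 3) F) 0 0, (γ : Matrix (Fin 3) (Fin 3) F) 0 1;
      (γ : Matrix (Fin 3) (Fin 3) F) 1 0, (γ : Matrix (Fin 3) (Fin 3) F) 1 1] : Matrix (Fin 2) (Fin 2) F) = !![0, -N; 1, T] := by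
    rw [hγ]; rfl
  have h22 : (γ : Matrix (Fin 3) (Fin 3) F) 2 2 = c := by rw [hγ]; rfl
  rw [h, h22, charpoly_companion]
  simp only [eval_add, eval_sub, eval_mul, eval_pow, eval_X, eval_C]

end Algebra

variable {F : Type*} [Field F] [ValuativeRel F] [TopologicalSpace F] [IsNonarchimedeanLocalField F] [CharZero F]
  [MeasurableSpace F] [BorelSpace F] [MeasurableSpace (GL (Fin 3) F)] [BorelSpace (GL (Fin 3) F)]
  (Λ₀ : Subgroup Fˣ) [(Λ₀.map (Matrix.GeneralLinearGroup.scalar (Fin 3))).Normal]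
  {V : Type*} [AddCommGroup V] [Module ℂ V] (ρ : Representation ℂ (GL (Fin 3) F ⧸ Λ₀.map (Matrix.GeneralLinearGroup.scalar (Fin 3))) V)
  {B : V →ₗ⋆[ℂ] V →ₗ[ℂ] ℂ}
  (hρ : ρ.IsSmooth) (hsc : ρ.IsSupercuspidal) (hBinv : ∀ (g : GL (Fin 3) F ⧸ Λ₀.map (Matrix.GeneralLinearGroup.scalar (Fin 3))) (v w : V), B (ρ g v) (ρ g w) = B v w)
  {γ : GL (Fin 3) F} {T N c : F} (hγ : (γ : Matrix (Fin 3) (Fin 3) F) = !![0, -N, 0; 1, T, 0; 0, 0, c]) (hπc : c ^ 2 - T * c + N ≠ 0) (u u' : V)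

include hρ hsc hBinv hγ hπc in
/-- **(hcusp21) The companion slice is a cusp form along `N_{(2,1)}`** — ★ Theorem 20 (`Γ = A₃`)'s binder `hcusp21` VERBATIM (carrier `unipotentRadicalGL F (![0,0,1] : Fin 3 → Fin 2)`):
★ B4-E1 at the regular Levi element `γ` (`π(c) ≠ 0`) for the cusp form `g ↦ B u' (ρ(π g) u)`, then `Bool ↔ Fin 2`.
[cite: HarishChandra1970, Part VII §2 Thm 20, §8 Lemma 57] [cite: Rogawski1990, §4.13 p. 70] -/
theorem slice_hcusp21_companion (ν₀ : Measure ↥(unipotentRadicalGL F (![0, 0, 1] : Fin 3 → Fin 2))) [ν₀.IsHaarMeasure] (x : GL (Fin 3) F) :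
    ∫ n, (fun z : GL (Fin 3) F => B u' (ρ (QuotientGroup.mk (z * γ * z⁻¹) : GL (Fin 3) F ⧸ Λ₀.map (Matrix.GeneralLinearGroup.scalar (Fin 3))) u))
      (x * (n : GL (Fin 3) F)) ∂ν₀ = 0 := by
  haveI : T2Space F := (isLocalField F).toT2Space
  have hEq : unipotentRadicalGL F (![false, false, true] : Fin 3 → Bool) = unipotentRadicalGL F (![0, 0, 1] : Fin 3 → Fin 2) :=
    unipotentRadicalGL_eq_of_forall_le_iff fun i j => by fin_cases i <;> fin_cases j <;> decide
  borelize ↥(unipotentRadicalGL F (![false, false, true] : Fin 3 → Bool))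
  refine integral_comp_coe_eq_zero_of_eq hEq
    (fun g : GL (Fin 3) F => B u' (ρ (QuotientGroup.mk ((x * g) * γ * (x * g)⁻¹) : GL (Fin 3) F ⧸ Λ₀.map (Matrix.GeneralLinearGroup.scalar (Fin 3))) u))
    (fun ν₁ hν₁ => ?_) ν₀
  haveI := hν₁
  have hcusp : ∀ a b : GL (Fin 3) F, ∫ uu : ↥(unipotentRadicalGL F (![false, false, true] : Fin 3 → Bool)),
      B u' (ρ (QuotientGroup.mk (a * (uu : GL (Fin 3) F) * b) : GL (Fin 3) F ⧸ Λ₀.map (Matrix.GeneralLinearGroup.scalar (Fin 3))) u) ∂ν₁ = 0 :=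
    fun a b => integral_sesqForm_apply_translate_unipotentRadicalGL_comp_mk_eq_zero' Λ₀ ρ hρ hsc
      (c := (![false, false, true] : Fin 3 → Bool)) ⟨fun t => by rcases Bool.eq_false_or_eq_true t with rfl | rfl <;> [exact ⟨2, rfl⟩; exact ⟨0, rfl⟩], inferInstance⟩
      (by decide) ν₁ hBinv a b u u'
  have hE := integral_unipotentRadical21_conj_eq_zero_of_cuspForm ν₁ (leviBlock_mem_standardLeviGL hγ)
    (by rw [eval_charpoly_topLeft_companion hγ]; exact hπc)
    (fun g : GL (Fin 3) F => B u' (ρ (QuotientGroup.mk g : GL (Fin 3) F ⧸ Λ₀.map (Matrix.GeneralLinearGroup.scalar (Fin 3))) u)) hcusp x x⁻¹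
  have heq : (fun uu : ↥(unipotentRadicalGL F (![false, false, true] : Fin 3 → Bool)) =>
      B u' (ρ (QuotientGroup.mk ((x * (uu : GL (Fin 3) F)) * γ * (x * (uu : GL (Fin 3) F))⁻¹) : GL (Fin 3) F ⧸ Λ₀.map (Matrix.GeneralLinearGroup.scalar (Fin 3))) u)) =
      fun uu : ↥(unipotentRadicalGL F (![false, false, true] : Fin 3 → Bool)) =>
        B u' (ρ (QuotientGroup.mk (x * ((uu : GL (Fin 3) F) * γ * ((uu : GL (Fin 3) F))⁻¹) * x⁻¹) : GL (Fin 3) F ⧸ Λ₀.map (Matrix.GeneralLinearGroup.scalar (Fin 3))) u) := by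
    funext uu; congr 4; group
  rw [heq]; exact hE

include hρ hsc hBinv hγ hπc in
/-- **(hcusp21bar) The companion slice is a cusp form along `N̄_{(2,1)}`** — ★ Theorem 20 (`Γ = A₃`)'s binder `hcusp21bar` VERBATIM (carrier
`unipotentRadicalGL F (![1,1,0] : Fin 3 → Fin 2)`): ★ B4-E1 (opposite) at `γ`, the cusp property along the opposite radical ★ B4-J, then `Bool ↔ Fin 2`.
[cite: HarishChandra1970, Part VII §2 Thm 20, §8 Lemma 57] [cite: Rogawski1990, §4.13 p. 70] -/
theorem slice_hcusp21bar_companion (ν₀ : Measure ↥(unipotentRadicalGL F (![1, 1, 0] : Fin 3 → Fin 2))) [ν₀.IsHaarMeasure] (x : GL (Fin 3) F) :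
    ∫ n, (fun z : GL (Fin 3) F => B u' (ρ (QuotientGroup.mk (z * γ * z⁻¹) : GL (Fin 3) F ⧸ Λ₀.map (Matrix.GeneralLinearGroup.scalar (Fin 3))) u))
      (x * (n : GL (Fin 3) F)) ∂ν₀ = 0 := by
  haveI : T2Space F := (isLocalField F).toT2Space
  have hEq : unipotentRadicalGL F (![true, true, false] : Fin 3 → Bool) = unipotentRadicalGL F (![1, 1, 0] : Fin 3 → Fin 2) :=
    unipotentRadicalGL_eq_of_forall_le_iff fun i j => by fin_cases i <;> fin_cases j <;> decide
  borelize ↥(unipotentRadicalGL F (![true, true, false] : Fin 3 → Bool))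
  refine integral_comp_coe_eq_zero_of_eq hEq
    (fun g : GL (Fin 3) F => B u' (ρ (QuotientGroup.mk ((x * g) * γ * (x * g)⁻¹) : GL (Fin 3) F ⧸ Λ₀.map (Matrix.GeneralLinearGroup.scalar (Fin 3))) u))
    (fun ν₁ hν₁ => ?_) ν₀
  haveI := hν₁
  have hcusp : ∀ a b : GL (Fin 3) F, ∫ vv : ↥(unipotentRadicalGL F (![true, true, false] : Fin 3 → Bool)),
      B u' (ρ (QuotientGroup.mk (a * (vv : GL (Fin 3) F) * b) : GL (Fin 3) F ⧸ Λ₀.map (Matrix.GeneralLinearGroup.scalar (Fin 3))) u) ∂ν₁ = 0 :=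
    fun a b => integral_sesqForm_apply_translate_unipotentRadicalGL_opposite_comp_mk_eq_zero Λ₀ ρ hρ hsc (c₁ := (![false, true, true] : Fin 3 → Bool))
      (c₂ := (![true, true, false] : Fin 3 → Bool))
      ⟨fun t => by rcases Bool.eq_false_or_eq_true t with rfl | rfl <;> [exact ⟨1, rfl⟩; exact ⟨0, rfl⟩], inferInstance⟩ (by decide)
      (fun i => by fin_cases i <;> rfl) ν₁ hBinv a b u u'
  have hE := integral_oppositeUnipotentRadical21_conj_eq_zero_of_cuspForm ν₁ (leviBlock_mem_standardLeviGL hγ)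
    (by rw [eval_charpoly_topLeft_companion hγ]; exact hπc)
    (fun g : GL (Fin 3) F => B u' (ρ (QuotientGroup.mk g : GL (Fin 3) F ⧸ Λ₀.map (Matrix.GeneralLinearGroup.scalar (Fin 3))) u)) hcusp x x⁻¹
  have heq : (fun vv : ↥(unipotentRadicalGL F (![true, true, false] : Fin 3 → Bool)) =>
      B u' (ρ (QuotientGroup.mk ((x * (vv : GL (Fin 3) F)) * γ * (x * (vv : GL (Fin 3) F))⁻¹) : GL (Fin 3) F ⧸ Λ₀.map (Matrix.GeneralLinearGroup.scalar (Fin 3))) u)) =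
      fun vv : ↥(unipotentRadicalGL F (![true, true, false] : Fin 3 → Bool)) =>
        B u' (ρ (QuotientGroup.mk (x * ((vv : GL (Fin 3) F) * γ * ((vv : GL (Fin 3) F))⁻¹) * x⁻¹) : GL (Fin 3) F ⧸ Λ₀.map (Matrix.GeneralLinearGroup.scalar (Fin 3))) u) := by
    funext vv; congr 4; group
  rw [heq]; exact hE

end Summit.HodgeConjecture.HodgeConjecture.Cruxes.H413.K2E3GL3SupercuspOrbitalSliceMixedCuspidal

end
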